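/-
Copyright (c) 2026 the pub-hodgecm-mathlib formalisation cell (harness21).  Prover seat hodgecm-mathlib-LH4-p03 (g4) on line LH3 (closer stub `stub_N9`, N9 «Transf» road),
brick (J-JOIN) (LH3-plan (g3) deal 2026-09-02T08:01:46Z over skeleton v3.3-DEV); 2026-09-02.
-/
import Literature.NumberTheory.Rogawski1990.ArchJumpAgreementOfBricks     -- ★ p850355 (this seat) (J-HEAD): `agreesOnAdmissibleCoveredSlots_of_bricks`, `slotSign_zero_ne_slotSign_two`; brings `orbFamGExt`, `stOrbFamH`, `HcSemireg`, …
import Literature.NumberTheory.Rogawski1990.ArchTransfFamilyWallGeometry   -- ★ p850239 (F0P3a-p09 (g5)) B1: `injective_of_pair_of_third`, re-exported ★ `circleExp_ne_of_abs_sub_lt_two_pi`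
import HarnessLib

/-!
# (J-JOIN): the residual `JumpBricksStatement` of organ J from the two SIDE heads and the book identity — the joiner picks ONE `G`-semiregular wall point per covered wall
# (Shelstad 1979 §4; Bouaziz 1994 §3.2 (I₃); Rogawski 1990 §8.2)

Topic `NumberTheory/Rogawski1990`; namespace `Literature.NumberTheory.Rogawski1990`.  THEOREMS ONLY (no `def`, no instance, no notation, no axiom, no named fact, no `sorry`);
kernel lane `--supports stmt-HodgeConjecture-24833`.  Cell `pub/hodgecm-mathlib` (D-0151), crux H413 = `stmt-HodgeConjecture-24833`; line LH3 (closer stub `stub_N9`), leaf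
`F0_P3c_StubN9Direct` skeleton v3.3-DEV: organ J := ★ `agreesOnAdmissibleCoveredSlots_of_bricks` ∘ `stub_N9jumpBricks : JumpBricksStatement` (:116).  THIS FILE closes
`JumpBricksStatement`'s body from THREE named side bricks, fixing token-exact what each side hand delivers (LH3-plan (g3) 08:01:46Z (J-JOIN); census LH4-p03 (g4) 08:14Z):

* **(H-SIDE)** `hH` — at EVERY `G`-semiregular point `s` of a covered compact wall `(S, w)` (`S` admissible): ONE smooth `fH` whose stable family member jumps along the normal by
  `bookH S w ·` its Cayley value, the Cayley value `≠ 0` ((J-H) ★ p850206∕p850334 LH10-p02 + (N1) ★ p850361 LH2-p04 + (N3) ★ p850341 LH5-p04 + (A0) F0P3a-p05);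
* **(G′-SIDE)** `hG` — the mirror for the wall-extended genuine family `orbFamGExt` in the twisted currency `eρ′·F` along `hcNrm w 0 2`, with `bookG S w` and the extra datum
  `w ∈ splitChartPlaces L α` (admissibility of the Cayley chart `insert w S`, supplied here from coveredness) ((J-G′-JUMP) ★ p850303 LH3-p02 + (J-G′-BLOCK) F0P3-p02 + (c-wall) ★
  LH5-p03 + (K0±-FORM-TRANSPORT) ★ p850353 F0P3a-p07 + (NONDEG-G′) F0P3b-p01 + (M-UNFOLD) LH5-p02);
* **(BOOK)** `hbook : bookH S w = 2 · bookG S w` at admissible covered walls ((J-BOOK), this seat: `2i·C₁∕C₂ = 2·(i·C₁∕C₂)`, the rank-one ratio);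
* §3 (ED. 2) **`jumpBricks_of_sides_std`**, **`agreesOnAdmissibleCoveredSlots_of_sides_std`** — the same with the SHARED RANK-ONE LITERALS `bookH := 2·I·C₁∕C₂`,
  `bookG := I·C₁∕C₂` (LH3-plan (g3) RULINGS #8: one standard datum `(U(J), μ₀, μ₀′, C₁, C₂)` bound by every side), so no book hypothesis remains.

Both side heads carry, as their LAST antecedent, the `jc`-free SMOOTH clause of the relevant membership (`∀ a′, ArchSmooth … a′ → ArchHcSmoothOneSided (slotSign L α)
(orbFamGExt L α ν′ a′)` ∕ `∀ fH, ArchSmooth₂ L fH → ArchBzSmoothBounded (stOrbFamH L νH fH)`; LH3-plan (g3) 08:05:31Z «= with ONE ADDED ANTECEDENT per side»): the Cayley value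
is then READ BY CONTINUITY inside `InRegG (insert w S)` ∕ `InRegS (insert w S)` ((V1-G′)∕(V1-H)); the joiner feeds them from `hHC`∕`hBZ` (`(hHC a′ ha′).2.2.1`, `.smoothBounded`).

The book constants `bookH bookG : Finset W → W → ℂ` may depend on the label and the place, NOT on the wall point or the test function (that independence is the content of
(I₃)).  The joiner's only own mathematics: a `G`-semiregular point exists on every compact wall (§1 `exists_hcSemireg_zero_two`: angles `(0,1,0)` at `w`, `x = 1` on `S`,
`(0,1,2)` at the other compact places — all differences `< 2π`), and a covered place is a split-chart place (§1 `mem_splitChartPlaces_of_isIndefiniteAt`).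
HONEST LABEL: HC_CM is proved only modulo the 7 printed citations (2 remaining: hLiu418 = stmt-HodgeConjecture-24832, h413 = stmt-HodgeConjecture-24833) until rung 0 closes;
count-neutral (the three side bricks enter as hypotheses).

## References
* [Shelstad1979] D. Shelstad, *Characters and inner forms of a quasi-split group over ℝ*, Compositio Math. 39 (1979), §4 pp. 22–31 (Lemma 4.3, Prop. 4.5, Thm. 4.7).
* [Bouaziz1994IntegralesOrbitales] A. Bouaziz, *Intégrales orbitales sur les groupes de Lie réductifs*, Ann. Sci. ÉNS 27 (1994), §3.2 (I₃) p. 580; Rem. 2 p. 594.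
* [Rogawski1990] J. D. Rogawski, *Automorphic Representations of Unitary Groups in Three Variables*, Ann. of Math. Stud. 123 (1990), §3.6 p. 31; §8.2 pp. 119–122.
-/

set_option autoImplicit false

noncomputable section

open Filter Topology Complex Finset MeasureTheory NumberField NumberField.InfinitePlace
open scoped Classical
open Literature.NumberTheory.Automorphic Literature.NumberTheory.Automorphic.UnitaryGroup Literature.NumberTheory.Automorphic.ArchCartan
open Literature.NumberTheory.Automorphic.Shelstad1979.StableOrbitalIntegrals
open Literature.NumberTheory.GaloisRepresentations

namespace Literature.NumberTheory.Rogawski1990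

/-! ## §1 A semiregular point on every compact wall; covered places are split-chart places -/

section Points

variable {W : Type*}

/-- The three exponentials `e^{0·i}, e^{1·i}, e^{2·i}` are pairwise distinct (all differences have absolute value `≤ 2 < 2π`). [cite: Shelstad1979, §4 p. 22] -/
theorem injective_circleExp_zero_one_two : Function.Injective fun l : Fin 3 => Circle.exp ((![0, 1, 2] : Fin 3 → ℝ) l) := by
  have h10 : Circle.exp (1 : ℝ) ≠ Circle.exp 0 :=
    circleExp_ne_of_abs_sub_lt_two_pi one_ne_zero (by norm_num; linarith [Real.pi_gt_three])
  have h20 : Circle.exp (2 : ℝ) ≠ Circle.exp 0 :=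
    circleExp_ne_of_abs_sub_lt_two_pi two_ne_zero (by norm_num; linarith [Real.pi_gt_three])
  have h21 : Circle.exp (2 : ℝ) ≠ Circle.exp 1 :=
    circleExp_ne_of_abs_sub_lt_two_pi (by norm_num) (by norm_num; linarith [Real.pi_gt_three])
  refine injective_of_pair_of_third (x := (0 : Fin 3)) (y := 1) (by decide) ?_ fun l hl0 hl1 => ?_
  · simpa using h10.symm
  · obtain rfl : l = 2 := by
      fin_cases l
      · exact absurd rfl hl0
      · exact absurd rfl hl1
      · rfl
    exact ⟨by simpa using h20, by simpa using h21⟩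

/-- **A `G`-SEMIREGULAR POINT ON EVERY COMPACT WALL `(w, 0, 2)`** (★ `HcSemireg S w 0 2 s`): angles `(0, 1, 0)` at `w` (on the wall, third eigenvalue off it), `x = 1` at the split
places `S`, angles `(0, 1, 2)` at the other compact places (regular there). [cite: Shelstad1979, §4 p. 22] [cite: Rogawski1990, §8.2 p. 119] -/
theorem exists_hcSemireg_zero_two [DecidableEq W] (S : Finset W) {w : W} (hw : w ∉ S) :
    ∃ s : W → Fin 3 → ℝ, HcSemireg S w 0 2 s := by
  refine ⟨fun w' => if w' = w then ![0, 1, 0] else if w' ∈ S then ![1, 0, 0] else ![0, 1, 2], ?_, ?_, ?_, ?_⟩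
  · simp
  · simpa [hcThird_zero_two] using
      circleExp_ne_of_abs_sub_lt_two_pi (a := (1 : ℝ)) (b := 0) one_ne_zero (by norm_num; linarith [Real.pi_gt_three])
  · intro w' hw' hne
    simp only [if_neg hne, if_neg hw']
    exact injective_circleExp_zero_one_two
  · intro w' hw'
    have hne : w' ≠ w := fun h => hw (h ▸ hw')
    simp [if_neg hne, if_pos hw']

end Points

section Split

variable (L : Type) [Field L] (α : Fin 3 → L)

/-- At an indefinite place of the slot-sign pattern the FORM signs are not all equal (slot signs are form signs re-indexed by ★ `lineOf`). [cite: Rogawski1990, §3.6 p. 31] -/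
theorem formSign_not_definite_of_isIndefiniteAt {w : {w : InfinitePlace L // IsComplex w}} (hind : IsIndefiniteAt (slotSign L α) w) :
    ¬ (formSign L α w 0 = formSign L α w 1 ∧ formSign L α w 1 = formSign L α w 2) := by
  intro hdef
  apply hind
  have hall : ∀ i, formSign L α w i = formSign L α w 0 := fun i => by
    fin_cases i
    · rfl
    · exact hdef.1.symm
    · exact (hdef.1.trans hdef.2).symm
  simp only [slotSign_apply, hall]
  exact ⟨trivial, trivial⟩

/-- **A COVERED place is a SPLIT-CHART place of the frame** (indefinite ⇒ the boost plane `(lineOf 0, lineOf 2)` is hyperbolic, ★ `mem_splitChartPlaces_of_frame`): the Cayley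
chart `insert w S` of the `G′`-atlas is admissible. [cite: Rogawski1990, §3.6 p. 31; §14.2 p. 232] -/
theorem mem_splitChartPlaces_of_isIndefiniteAt {w : {w : InfinitePlace L // IsComplex w}} (hα : ∀ i, α i ≠ 0) (hreal : ∀ i, (w.1.embedding (α i)).im = 0)
    (hind : IsIndefiniteAt (slotSign L α) w) : w ∈ splitChartPlaces L α :=
  mem_splitChartPlaces_of_frame hα hreal (formSign_not_definite_of_isIndefiniteAt L α hind)

end Split

/-! ## §2 The joiner -/

section Join

variable (L : Type) [Field L] [NumberField L] [IsCMField L] (α : Fin 3 → L)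
  [MeasurableSpace ↥(arch (↥(maximalRealSubfield L)) L (IsCMField.complexConj L) 3 (Matrix.diagonal α))]
  [BorelSpace ↥(arch (↥(maximalRealSubfield L)) L (IsCMField.complexConj L) 3 (Matrix.diagonal α))]
  [MeasurableSpace (↥(arch (↥(maximalRealSubfield L)) L (IsCMField.complexConj L) 2 (Matrix.of fun i j : Fin 2 => if i.val + j.val + 1 = 2 then (1 : L) else 0)) ×
      ↥(arch (↥(maximalRealSubfield L)) L (IsCMField.complexConj L) 1 (Matrix.of fun i j : Fin 1 => if i.val + j.val + 1 = 1 then (1 : L) else 0)))]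
  [BorelSpace (↥(arch (↥(maximalRealSubfield L)) L (IsCMField.complexConj L) 2 (Matrix.of fun i j : Fin 2 => if i.val + j.val + 1 = 2 then (1 : L) else 0)) ×
      ↥(arch (↥(maximalRealSubfield L)) L (IsCMField.complexConj L) 1 (Matrix.of fun i j : Fin 1 => if i.val + j.val + 1 = 1 then (1 : L) else 0)))]
  (ν' : Measure ↥(arch (↥(maximalRealSubfield L)) L (IsCMField.complexConj L) 3 (Matrix.diagonal α))) [IsFiniteMeasureOnCompacts ν'] [ν'.IsMulRightInvariant]
  (νH : Measure (↥(arch (↥(maximalRealSubfield L)) L (IsCMField.complexConj L) 2 (Matrix.of fun i j : Fin 2 => if i.val + j.val + 1 = 2 then (1 : L) else 0)) ×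
      ↥(arch (↥(maximalRealSubfield L)) L (IsCMField.complexConj L) 1 (Matrix.of fun i j : Fin 1 => if i.val + j.val + 1 = 1 then (1 : L) else 0))))
  [IsFiniteMeasureOnCompacts νH] [νH.IsMulRightInvariant]

/-- **(J-JOIN): `JumpBricksStatement`'s body from the two side heads and the book identity.**  For every admissible `S` and covered `w ∉ S` pick the semiregular wall point of
§1; the `H`-side head gives `fH` jumping by `bookH S w ·` (its Cayley value `≠ 0`), the `G′`-side head gives `a′` jumping by `bookG S w ·` (its twisted Cayley value `≠ 0`),
and `bookH S w = 2 · bookG S w` is (BOOK).  Each side may READ ITS CAYLEY VALUE BY CONTINUITY from the `jc`-free smooth clause of the membership ((I₂): `hsm` = clause 3 of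
★ `ArchHCSpaceG`, `hsmH` = clause 3 of ★ `ArchBouazizSpaceH`; LH3-plan (g3) RULINGS #7 ∕ 08:05:31Z), which the side heads receive as their last antecedent. [cite: Shelstad1979, Prop. 4.5 (p. 26); Thm. 4.7 (IIIb) (p. 31)] [cite: Bouaziz1994IntegralesOrbitales, §3.2 (I₃) p. 580]
[cite: Rogawski1990, §8.2 Prop. 8.2.1 (c) p. 119] -/
theorem jumpBricks_of_sides (hα : ∀ i, α i ≠ 0) (hreal : ∀ (w : {w : InfinitePlace L // IsComplex w}) (i : Fin 3), (w.1.embedding (α i)).im = 0)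
    (hsm : ∀ a' : ↥(arch (↥(maximalRealSubfield L)) L (IsCMField.complexConj L) 3 (Matrix.diagonal α)) → ℂ,
      ArchSmooth L 3 (Matrix.diagonal α) a' → ArchHcSmoothOneSided (slotSign L α) (orbFamGExt L α ν' a'))
    (hsmH : ∀ fH : (↥(arch (↥(maximalRealSubfield L)) L (IsCMField.complexConj L) 2 (Matrix.of fun i j : Fin 2 => if i.val + j.val + 1 = 2 then (1 : L) else 0)) ×
        ↥(arch (↥(maximalRealSubfield L)) L (IsCMField.complexConj L) 1 (Matrix.of fun i j : Fin 1 => if i.val + j.val + 1 = 1 then (1 : L) else 0))) → ℂ,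
      ArchSmooth₂ L fH → ArchBzSmoothBounded (stOrbFamH L νH fH))
    {bookH bookG : Finset {w : InfinitePlace L // IsComplex w} → {w : InfinitePlace L // IsComplex w} → ℂ}
    (hH : ∀ (S : Finset {w : InfinitePlace L // IsComplex w}) (w : {w : InfinitePlace L // IsComplex w}) (s : {w : InfinitePlace L // IsComplex w} → Fin 3 → ℝ),
      (∀ w' ∈ S, w' ∈ splitChartPlaces L α) → IsCoveredWall (slotSign L α) S w → HcSemireg S w 0 2 s →
      (∀ fH : (↥(arch (↥(maximalRealSubfield L)) L (IsCMField.complexConj L) 2 (Matrix.of fun i j : Fin 2 => if i.val + j.val + 1 = 2 then (1 : L) else 0)) ×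
        ↥(arch (↥(maximalRealSubfield L)) L (IsCMField.complexConj L) 1 (Matrix.of fun i j : Fin 1 => if i.val + j.val + 1 = 1 then (1 : L) else 0))) → ℂ,
        ArchSmooth₂ L fH → ArchBzSmoothBounded (stOrbFamH L νH fH)) →
        ∃ fH : (↥(arch (↥(maximalRealSubfield L)) L (IsCMField.complexConj L) 2 (Matrix.of fun i j : Fin 2 => if i.val + j.val + 1 = 2 then (1 : L) else 0)) ×
        ↥(arch (↥(maximalRealSubfield L)) L (IsCMField.complexConj L) 1 (Matrix.of fun i j : Fin 1 => if i.val + j.val + 1 = 1 then (1 : L) else 0))) → ℂ,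
          ArchSmooth₂ L fH ∧
            HasOneSidedJump (fun ν : ℝ => stOrbFamH L νH fH S (s + ν • nrm w)) (bookH S w * stOrbFamH L νH fH (insert w S) (cayPt w s)) ∧
            stOrbFamH L νH fH (insert w S) (cayPt w s) ≠ 0)
    (hG : ∀ (S : Finset {w : InfinitePlace L // IsComplex w}) (w : {w : InfinitePlace L // IsComplex w}) (s : {w : InfinitePlace L // IsComplex w} → Fin 3 → ℝ),
      (∀ w' ∈ S, w' ∈ splitChartPlaces L α) → IsCoveredWall (slotSign L α) S w → w ∈ splitChartPlaces L α → HcSemireg S w 0 2 s →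
      (∀ a' : ↥(arch (↥(maximalRealSubfield L)) L (IsCMField.complexConj L) 3 (Matrix.diagonal α)) → ℂ, ArchSmooth L 3 (Matrix.diagonal α) a' → ArchHcSmoothOneSided (slotSign L α) (orbFamGExt L α ν' a')) →
        ∃ a' : ↥(arch (↥(maximalRealSubfield L)) L (IsCMField.complexConj L) 3 (Matrix.diagonal α)) → ℂ,
          ArchSmooth L 3 (Matrix.diagonal α) a' ∧
            HasOneSidedJump (fun ν : ℝ => archERhoG S (s + ν • hcNrm w 0 2) * orbFamGExt L α ν' a' S (s + ν • hcNrm w 0 2))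
              (bookG S w * (archERhoG (insert w S) (hcCayPt w 0 2 s) * orbFamGExt L α ν' a' (insert w S) (hcCayPt w 0 2 s))) ∧
            orbFamGExt L α ν' a' (insert w S) (hcCayPt w 0 2 s) ≠ 0)
    (hbook : ∀ (S : Finset {w : InfinitePlace L // IsComplex w}) (w : {w : InfinitePlace L // IsComplex w}), (∀ w' ∈ S, w' ∈ splitChartPlaces L α) → IsCoveredWall (slotSign L α) S w → bookH S w = 2 * bookG S w) :
    ∀ (S : Finset {w : InfinitePlace L // IsComplex w}) (w : {w : InfinitePlace L // IsComplex w}), (∀ w' ∈ S, w' ∈ splitChartPlaces L α) → IsCoveredWall (slotSign L α) S w →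
      ∃ (s : {w : InfinitePlace L // IsComplex w} → Fin 3 → ℝ) (cH cG : ℂ), HcSemireg S w 0 2 s ∧
        (∃ fH : (↥(arch (↥(maximalRealSubfield L)) L (IsCMField.complexConj L) 2 (Matrix.of fun i j : Fin 2 => if i.val + j.val + 1 = 2 then (1 : L) else 0)) ×
        ↥(arch (↥(maximalRealSubfield L)) L (IsCMField.complexConj L) 1 (Matrix.of fun i j : Fin 1 => if i.val + j.val + 1 = 1 then (1 : L) else 0))) → ℂ,
            ArchSmooth₂ L fH ∧
              HasOneSidedJump (fun ν : ℝ => stOrbFamH L νH fH S (s + ν • nrm w)) (cH * stOrbFamH L νH fH (insert w S) (cayPt w s)) ∧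
              stOrbFamH L νH fH (insert w S) (cayPt w s) ≠ 0) ∧
        (∃ a' : ↥(arch (↥(maximalRealSubfield L)) L (IsCMField.complexConj L) 3 (Matrix.diagonal α)) → ℂ,
            ArchSmooth L 3 (Matrix.diagonal α) a' ∧
              HasOneSidedJump (fun ν : ℝ => archERhoG S (s + ν • hcNrm w 0 2) * orbFamGExt L α ν' a' S (s + ν • hcNrm w 0 2))
                (cG * (archERhoG (insert w S) (hcCayPt w 0 2 s) * orbFamGExt L α ν' a' (insert w S) (hcCayPt w 0 2 s))) ∧
              orbFamGExt L α ν' a' (insert w S) (hcCayPt w 0 2 s) ≠ 0) ∧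
        cH = 2 * cG := by
  intro S w hS hcov
  obtain ⟨s, hs⟩ := exists_hcSemireg_zero_two S hcov.1
  exact ⟨s, bookH S w, bookG S w, hs, hH S w s hS hcov hs hsmH,
    hG S w s hS hcov (mem_splitChartPlaces_of_isIndefiniteAt L α hα (hreal w) hcov.2) hs hsm, hbook S w hS hcov⟩

/-- **ORGAN J FROM THE TWO SIDE HEADS AND THE BOOK IDENTITY** (★ `agreesOnAdmissibleCoveredSlots_of_bricks` ∘ `jumpBricks_of_sides`).
[cite: Shelstad1979, Thm. 4.7 (IIIb) (p. 31)] [cite: Bouaziz1994IntegralesOrbitales, §3.2 (I₃) p. 580; Rem. 2 p. 594] [cite: Rogawski1990, §8.2 Prop. 8.2.1 (c) p. 119] -/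
theorem agreesOnAdmissibleCoveredSlots_of_sides (hα : ∀ i, α i ≠ 0) (hreal : ∀ (w : {w : InfinitePlace L // IsComplex w}) (i : Fin 3), (w.1.embedding (α i)).im = 0)
    (jc' : Finset {w : InfinitePlace L // IsComplex w} → {w : InfinitePlace L // IsComplex w} → Fin 3 → Fin 3 → ℂ) (jcH : Finset {w : InfinitePlace L // IsComplex w} → {w : InfinitePlace L // IsComplex w} → ℂ)
    (hHC : ∀ a' : ↥(arch (↥(maximalRealSubfield L)) L (IsCMField.complexConj L) 3 (Matrix.diagonal α)) → ℂ,
      ArchSmooth L 3 (Matrix.diagonal α) a' → ArchHCSpaceG (slotSign L α) jc' (orbFamGExt L α ν' a'))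
    (hBZ : ∀ fH : (↥(arch (↥(maximalRealSubfield L)) L (IsCMField.complexConj L) 2 (Matrix.of fun i j : Fin 2 => if i.val + j.val + 1 = 2 then (1 : L) else 0)) ×
        ↥(arch (↥(maximalRealSubfield L)) L (IsCMField.complexConj L) 1 (Matrix.of fun i j : Fin 1 => if i.val + j.val + 1 = 1 then (1 : L) else 0))) → ℂ,
      ArchSmooth₂ L fH → ArchBouazizSpaceH jcH (stOrbFamH L νH fH))
    {bookH bookG : Finset {w : InfinitePlace L // IsComplex w} → {w : InfinitePlace L // IsComplex w} → ℂ}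
    (hH : ∀ (S : Finset {w : InfinitePlace L // IsComplex w}) (w : {w : InfinitePlace L // IsComplex w}) (s : {w : InfinitePlace L // IsComplex w} → Fin 3 → ℝ),
      (∀ w' ∈ S, w' ∈ splitChartPlaces L α) → IsCoveredWall (slotSign L α) S w → HcSemireg S w 0 2 s →
      (∀ fH : (↥(arch (↥(maximalRealSubfield L)) L (IsCMField.complexConj L) 2 (Matrix.of fun i j : Fin 2 => if i.val + j.val + 1 = 2 then (1 : L) else 0)) ×
        ↥(arch (↥(maximalRealSubfield L)) L (IsCMField.complexConj L) 1 (Matrix.of fun i j : Fin 1 => if i.val + j.val + 1 = 1 then (1 : L) else 0))) → ℂ,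
        ArchSmooth₂ L fH → ArchBzSmoothBounded (stOrbFamH L νH fH)) →
        ∃ fH : (↥(arch (↥(maximalRealSubfield L)) L (IsCMField.complexConj L) 2 (Matrix.of fun i j : Fin 2 => if i.val + j.val + 1 = 2 then (1 : L) else 0)) ×
        ↥(arch (↥(maximalRealSubfield L)) L (IsCMField.complexConj L) 1 (Matrix.of fun i j : Fin 1 => if i.val + j.val + 1 = 1 then (1 : L) else 0))) → ℂ,
          ArchSmooth₂ L fH ∧
            HasOneSidedJump (fun ν : ℝ => stOrbFamH L νH fH S (s + ν • nrm w)) (bookH S w * stOrbFamH L νH fH (insert w S) (cayPt w s)) ∧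
            stOrbFamH L νH fH (insert w S) (cayPt w s) ≠ 0)
    (hG : ∀ (S : Finset {w : InfinitePlace L // IsComplex w}) (w : {w : InfinitePlace L // IsComplex w}) (s : {w : InfinitePlace L // IsComplex w} → Fin 3 → ℝ),
      (∀ w' ∈ S, w' ∈ splitChartPlaces L α) → IsCoveredWall (slotSign L α) S w → w ∈ splitChartPlaces L α → HcSemireg S w 0 2 s →
      (∀ a' : ↥(arch (↥(maximalRealSubfield L)) L (IsCMField.complexConj L) 3 (Matrix.diagonal α)) → ℂ, ArchSmooth L 3 (Matrix.diagonal α) a' → ArchHcSmoothOneSided (slotSign L α) (orbFamGExt L α ν' a')) →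
        ∃ a' : ↥(arch (↥(maximalRealSubfield L)) L (IsCMField.complexConj L) 3 (Matrix.diagonal α)) → ℂ,
          ArchSmooth L 3 (Matrix.diagonal α) a' ∧
            HasOneSidedJump (fun ν : ℝ => archERhoG S (s + ν • hcNrm w 0 2) * orbFamGExt L α ν' a' S (s + ν • hcNrm w 0 2))
              (bookG S w * (archERhoG (insert w S) (hcCayPt w 0 2 s) * orbFamGExt L α ν' a' (insert w S) (hcCayPt w 0 2 s))) ∧
            orbFamGExt L α ν' a' (insert w S) (hcCayPt w 0 2 s) ≠ 0)
    (hbook : ∀ (S : Finset {w : InfinitePlace L // IsComplex w}) (w : {w : InfinitePlace L // IsComplex w}), (∀ w' ∈ S, w' ∈ splitChartPlaces L α) → IsCoveredWall (slotSign L α) S w → bookH S w = 2 * bookG S w) :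
    AgreesOnAdmissibleCoveredSlots L α jc' jcH :=
  agreesOnAdmissibleCoveredSlots_of_bricks L α ν' νH hα hreal jc' jcH hHC hBZ
    (jumpBricks_of_sides L α ν' νH hα hreal (fun a' ha' => (hHC a' ha').2.2.1) (fun fH hfH => (hBZ fH hfH).smoothBounded) hH hG hbook)

end Join


/-! ## §3 ED. 2 — the SHARED RANK-ONE DATUM literals (LH3-plan (g3) RULINGS #8 (ii), 2026-09-02T08:12:08Z): `bookH := 2·I·C₁∕C₂`, `bookG := I·C₁∕C₂`, (BOOK) by `ring` -/

section Std

variable (L : Type) [Field L] [NumberField L] [IsCMField L] (α : Fin 3 → L)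
  [MeasurableSpace ↥(arch (↥(maximalRealSubfield L)) L (IsCMField.complexConj L) 3 (Matrix.diagonal α))]
  [BorelSpace ↥(arch (↥(maximalRealSubfield L)) L (IsCMField.complexConj L) 3 (Matrix.diagonal α))]
  [MeasurableSpace (↥(arch (↥(maximalRealSubfield L)) L (IsCMField.complexConj L) 2 (Matrix.of fun i j : Fin 2 => if i.val + j.val + 1 = 2 then (1 : L) else 0)) ×
      ↥(arch (↥(maximalRealSubfield L)) L (IsCMField.complexConj L) 1 (Matrix.of fun i j : Fin 1 => if i.val + j.val + 1 = 1 then (1 : L) else 0)))]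
  [BorelSpace (↥(arch (↥(maximalRealSubfield L)) L (IsCMField.complexConj L) 2 (Matrix.of fun i j : Fin 2 => if i.val + j.val + 1 = 2 then (1 : L) else 0)) ×
      ↥(arch (↥(maximalRealSubfield L)) L (IsCMField.complexConj L) 1 (Matrix.of fun i j : Fin 1 => if i.val + j.val + 1 = 1 then (1 : L) else 0)))]
  (ν' : Measure ↥(arch (↥(maximalRealSubfield L)) L (IsCMField.complexConj L) 3 (Matrix.diagonal α))) [IsFiniteMeasureOnCompacts ν'] [ν'.IsMulRightInvariant]
  (νH : Measure (↥(arch (↥(maximalRealSubfield L)) L (IsCMField.complexConj L) 2 (Matrix.of fun i j : Fin 2 => if i.val + j.val + 1 = 2 then (1 : L) else 0)) ×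
      ↥(arch (↥(maximalRealSubfield L)) L (IsCMField.complexConj L) 1 (Matrix.of fun i j : Fin 1 => if i.val + j.val + 1 = 1 then (1 : L) else 0))))
  [IsFiniteMeasureOnCompacts νH] [νH.IsMulRightInvariant]

/-- **(J-JOIN) WITH THE SHARED RANK-ONE LITERALS.**  Both side heads bind the SAME real constants `C₁, C₂` (the (K0±) jump constant and the (A0) Cayley-limit constant of ONE
standard rank-one datum `(U(J), μ₀, μ₀′)`, RULINGS #8 (i); HOME cert `SharedRankOneDatum.cert`) and conclude with the LITERAL book constants `2·I·C₁∕C₂` (the `H` side: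
the stable doubling `γ, γ″` of Prop. 8.2.1 (c)) and `I·C₁∕C₂` (the `G′` side); the book identity `2·I·C₁∕C₂ = 2·(I·C₁∕C₂)` is `ring`, so `JumpBricksStatement`'s body follows
from the two side heads ALONE. [cite: Rogawski1990, §8.2 Prop. 8.2.1 (c) p. 119] [cite: Shelstad1979, Prop. 4.5 (p. 26); Thm. 4.7 (IIIb) (p. 31)]
[cite: Bouaziz1994IntegralesOrbitales, §3.2 (I₃) p. 580] -/
theorem jumpBricks_of_sides_std (hα : ∀ i, α i ≠ 0) (hreal : ∀ (w : {w : InfinitePlace L // IsComplex w}) (i : Fin 3), (w.1.embedding (α i)).im = 0)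
    (hsm : ∀ a' : ↥(arch (↥(maximalRealSubfield L)) L (IsCMField.complexConj L) 3 (Matrix.diagonal α)) → ℂ,
      ArchSmooth L 3 (Matrix.diagonal α) a' → ArchHcSmoothOneSided (slotSign L α) (orbFamGExt L α ν' a'))
    (hsmH : ∀ fH : (↥(arch (↥(maximalRealSubfield L)) L (IsCMField.complexConj L) 2 (Matrix.of fun i j : Fin 2 => if i.val + j.val + 1 = 2 then (1 : L) else 0)) ×
        ↥(arch (↥(maximalRealSubfield L)) L (IsCMField.complexConj L) 1 (Matrix.of fun i j : Fin 1 => if i.val + j.val + 1 = 1 then (1 : L) else 0))) → ℂ,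
      ArchSmooth₂ L fH → ArchBzSmoothBounded (stOrbFamH L νH fH))
    (C₁ C₂ : ℝ)
    (hH : ∀ (S : Finset {w : InfinitePlace L // IsComplex w}) (w : {w : InfinitePlace L // IsComplex w}) (s : {w : InfinitePlace L // IsComplex w} → Fin 3 → ℝ),
      (∀ w' ∈ S, w' ∈ splitChartPlaces L α) → IsCoveredWall (slotSign L α) S w → HcSemireg S w 0 2 s →
      (∀ fH : (↥(arch (↥(maximalRealSubfield L)) L (IsCMField.complexConj L) 2 (Matrix.of fun i j : Fin 2 => if i.val + j.val + 1 = 2 then (1 : L) else 0)) ×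
        ↥(arch (↥(maximalRealSubfield L)) L (IsCMField.complexConj L) 1 (Matrix.of fun i j : Fin 1 => if i.val + j.val + 1 = 1 then (1 : L) else 0))) → ℂ,
        ArchSmooth₂ L fH → ArchBzSmoothBounded (stOrbFamH L νH fH)) →
        ∃ fH : (↥(arch (↥(maximalRealSubfield L)) L (IsCMField.complexConj L) 2 (Matrix.of fun i j : Fin 2 => if i.val + j.val + 1 = 2 then (1 : L) else 0)) ×
        ↥(arch (↥(maximalRealSubfield L)) L (IsCMField.complexConj L) 1 (Matrix.of fun i j : Fin 1 => if i.val + j.val + 1 = 1 then (1 : L) else 0))) → ℂ,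
          ArchSmooth₂ L fH ∧
            HasOneSidedJump (fun ν : ℝ => stOrbFamH L νH fH S (s + ν • nrm w)) ((2 * I * C₁ / C₂ : ℂ) * stOrbFamH L νH fH (insert w S) (cayPt w s)) ∧
            stOrbFamH L νH fH (insert w S) (cayPt w s) ≠ 0)
    (hG : ∀ (S : Finset {w : InfinitePlace L // IsComplex w}) (w : {w : InfinitePlace L // IsComplex w}) (s : {w : InfinitePlace L // IsComplex w} → Fin 3 → ℝ),
      (∀ w' ∈ S, w' ∈ splitChartPlaces L α) → IsCoveredWall (slotSign L α) S w → w ∈ splitChartPlaces L α → HcSemireg S w 0 2 s →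
      (∀ a' : ↥(arch (↥(maximalRealSubfield L)) L (IsCMField.complexConj L) 3 (Matrix.diagonal α)) → ℂ, ArchSmooth L 3 (Matrix.diagonal α) a' → ArchHcSmoothOneSided (slotSign L α) (orbFamGExt L α ν' a')) →
        ∃ a' : ↥(arch (↥(maximalRealSubfield L)) L (IsCMField.complexConj L) 3 (Matrix.diagonal α)) → ℂ,
          ArchSmooth L 3 (Matrix.diagonal α) a' ∧
            HasOneSidedJump (fun ν : ℝ => archERhoG S (s + ν • hcNrm w 0 2) * orbFamGExt L α ν' a' S (s + ν • hcNrm w 0 2))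
              ((I * C₁ / C₂ : ℂ) * (archERhoG (insert w S) (hcCayPt w 0 2 s) * orbFamGExt L α ν' a' (insert w S) (hcCayPt w 0 2 s))) ∧
            orbFamGExt L α ν' a' (insert w S) (hcCayPt w 0 2 s) ≠ 0) :
    ∀ (S : Finset {w : InfinitePlace L // IsComplex w}) (w : {w : InfinitePlace L // IsComplex w}), (∀ w' ∈ S, w' ∈ splitChartPlaces L α) → IsCoveredWall (slotSign L α) S w →
      ∃ (s : {w : InfinitePlace L // IsComplex w} → Fin 3 → ℝ) (cH cG : ℂ), HcSemireg S w 0 2 s ∧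
        (∃ fH : (↥(arch (↥(maximalRealSubfield L)) L (IsCMField.complexConj L) 2 (Matrix.of fun i j : Fin 2 => if i.val + j.val + 1 = 2 then (1 : L) else 0)) ×
        ↥(arch (↥(maximalRealSubfield L)) L (IsCMField.complexConj L) 1 (Matrix.of fun i j : Fin 1 => if i.val + j.val + 1 = 1 then (1 : L) else 0))) → ℂ,
            ArchSmooth₂ L fH ∧
              HasOneSidedJump (fun ν : ℝ => stOrbFamH L νH fH S (s + ν • nrm w)) (cH * stOrbFamH L νH fH (insert w S) (cayPt w s)) ∧
              stOrbFamH L νH fH (insert w S) (cayPt w s) ≠ 0) ∧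
        (∃ a' : ↥(arch (↥(maximalRealSubfield L)) L (IsCMField.complexConj L) 3 (Matrix.diagonal α)) → ℂ,
            ArchSmooth L 3 (Matrix.diagonal α) a' ∧
              HasOneSidedJump (fun ν : ℝ => archERhoG S (s + ν • hcNrm w 0 2) * orbFamGExt L α ν' a' S (s + ν • hcNrm w 0 2))
                (cG * (archERhoG (insert w S) (hcCayPt w 0 2 s) * orbFamGExt L α ν' a' (insert w S) (hcCayPt w 0 2 s))) ∧
              orbFamGExt L α ν' a' (insert w S) (hcCayPt w 0 2 s) ≠ 0) ∧
        cH = 2 * cG :=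
  jumpBricks_of_sides L α ν' νH hα hreal hsm hsmH (bookH := fun _ _ => (2 * I * C₁ / C₂ : ℂ)) (bookG := fun _ _ => (I * C₁ / C₂ : ℂ))
    hH hG (fun _ _ _ _ => by ring)

/-- **ORGAN J FROM THE TWO SIDE HEADS WITH THE SHARED RANK-ONE LITERALS** (no book hypothesis left). [cite: Rogawski1990, §8.2 Prop. 8.2.1 (c) p. 119]
[cite: Shelstad1979, Thm. 4.7 (IIIb) (p. 31)] [cite: Bouaziz1994IntegralesOrbitales, §3.2 (I₃) p. 580; Rem. 2 p. 594] -/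
theorem agreesOnAdmissibleCoveredSlots_of_sides_std (hα : ∀ i, α i ≠ 0) (hreal : ∀ (w : {w : InfinitePlace L // IsComplex w}) (i : Fin 3), (w.1.embedding (α i)).im = 0)
    (jc' : Finset {w : InfinitePlace L // IsComplex w} → {w : InfinitePlace L // IsComplex w} → Fin 3 → Fin 3 → ℂ) (jcH : Finset {w : InfinitePlace L // IsComplex w} → {w : InfinitePlace L // IsComplex w} → ℂ)
    (hHC : ∀ a' : ↥(arch (↥(maximalRealSubfield L)) L (IsCMField.complexConj L) 3 (Matrix.diagonal α)) → ℂ,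
      ArchSmooth L 3 (Matrix.diagonal α) a' → ArchHCSpaceG (slotSign L α) jc' (orbFamGExt L α ν' a'))
    (hBZ : ∀ fH : (↥(arch (↥(maximalRealSubfield L)) L (IsCMField.complexConj L) 2 (Matrix.of fun i j : Fin 2 => if i.val + j.val + 1 = 2 then (1 : L) else 0)) ×
        ↥(arch (↥(maximalRealSubfield L)) L (IsCMField.complexConj L) 1 (Matrix.of fun i j : Fin 1 => if i.val + j.val + 1 = 1 then (1 : L) else 0))) → ℂ,
      ArchSmooth₂ L fH → ArchBouazizSpaceH jcH (stOrbFamH L νH fH))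
    (C₁ C₂ : ℝ)
    (hH : ∀ (S : Finset {w : InfinitePlace L // IsComplex w}) (w : {w : InfinitePlace L // IsComplex w}) (s : {w : InfinitePlace L // IsComplex w} → Fin 3 → ℝ),
      (∀ w' ∈ S, w' ∈ splitChartPlaces L α) → IsCoveredWall (slotSign L α) S w → HcSemireg S w 0 2 s →
      (∀ fH : (↥(arch (↥(maximalRealSubfield L)) L (IsCMField.complexConj L) 2 (Matrix.of fun i j : Fin 2 => if i.val + j.val + 1 = 2 then (1 : L) else 0)) ×
        ↥(arch (↥(maximalRealSubfield L)) L (IsCMField.complexConj L) 1 (Matrix.of fun i j : Fin 1 => if i.val + j.val + 1 = 1 then (1 : L) else 0))) → ℂ,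
        ArchSmooth₂ L fH → ArchBzSmoothBounded (stOrbFamH L νH fH)) →
        ∃ fH : (↥(arch (↥(maximalRealSubfield L)) L (IsCMField.complexConj L) 2 (Matrix.of fun i j : Fin 2 => if i.val + j.val + 1 = 2 then (1 : L) else 0)) ×
        ↥(arch (↥(maximalRealSubfield L)) L (IsCMField.complexConj L) 1 (Matrix.of fun i j : Fin 1 => if i.val + j.val + 1 = 1 then (1 : L) else 0))) → ℂ,
          ArchSmooth₂ L fH ∧
            HasOneSidedJump (fun ν : ℝ => stOrbFamH L νH fH S (s + ν • nrm w)) ((2 * I * C₁ / C₂ : ℂ) * stOrbFamH L νH fH (insert w S) (cayPt w s)) ∧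
            stOrbFamH L νH fH (insert w S) (cayPt w s) ≠ 0)
    (hG : ∀ (S : Finset {w : InfinitePlace L // IsComplex w}) (w : {w : InfinitePlace L // IsComplex w}) (s : {w : InfinitePlace L // IsComplex w} → Fin 3 → ℝ),
      (∀ w' ∈ S, w' ∈ splitChartPlaces L α) → IsCoveredWall (slotSign L α) S w → w ∈ splitChartPlaces L α → HcSemireg S w 0 2 s →
      (∀ a' : ↥(arch (↥(maximalRealSubfield L)) L (IsCMField.complexConj L) 3 (Matrix.diagonal α)) → ℂ, ArchSmooth L 3 (Matrix.diagonal α) a' → ArchHcSmoothOneSided (slotSign L α) (orbFamGExt L α ν' a')) →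
        ∃ a' : ↥(arch (↥(maximalRealSubfield L)) L (IsCMField.complexConj L) 3 (Matrix.diagonal α)) → ℂ,
          ArchSmooth L 3 (Matrix.diagonal α) a' ∧
            HasOneSidedJump (fun ν : ℝ => archERhoG S (s + ν • hcNrm w 0 2) * orbFamGExt L α ν' a' S (s + ν • hcNrm w 0 2))
              ((I * C₁ / C₂ : ℂ) * (archERhoG (insert w S) (hcCayPt w 0 2 s) * orbFamGExt L α ν' a' (insert w S) (hcCayPt w 0 2 s))) ∧
            orbFamGExt L α ν' a' (insert w S) (hcCayPt w 0 2 s) ≠ 0) :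
    AgreesOnAdmissibleCoveredSlots L α jc' jcH :=
  agreesOnAdmissibleCoveredSlots_of_bricks L α ν' νH hα hreal jc' jcH hHC hBZ
    (jumpBricks_of_sides_std L α ν' νH hα hreal (fun a' ha' => (hHC a' ha').2.2.1) (fun fH hfH => (hBZ fH hfH).smoothBounded) C₁ C₂ hH hG)

end Std

end Literature.NumberTheory.Rogawski1990

end
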